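import Literature.AlgebraicGeometry.Frobenioids.PadicKummerGaloisChartCoset
import Literature.AlgebraicGeometry.Frobenioids.PadicKummerIsoOfFunctor
import HarnessLib

/-!
# Frobenioids II, Theorem 2.4 (i) for the `p`-adic Frobenioids of §2 themselves (row (α), capstone D5)

Mochizuki, *The geometry of Frobenioids II*, Kyushu J. Math. **62** (2008) 401–460, §2, Theorem 2.4 (i) pp. 19–20
[cite: MochizukiFrdII2008, Thm 2.4 (i) p.19].

PROOF-ONLY capstone (seat abc-iut-L1-t7, gen 4; GAP row G-L1t7-α). For two `pᵢ`-adic Frobenioids `Cᵢ = dᵢ.frobenioid`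
over the bases `B(G_{ℚ_{pᵢ}})⁰ → D₀` of §2 (abc-iut-w5-d229's small model, `hdᵢ`), a fully faithful functor
`Ψ : C₁ ⥤ C₂` (the equivalence of print), an object `A₁` with `(A₁)_D` and `(Ψ A₁)_D` Galois, open normal
`Hᵢ ⊆ G_{ℚ_{pᵢ}}`, and the printed inputs BY NAME — (hO) "`Ψ` preserves `O^⊳(−)`" ([FrdI] Cor. 4.10/4.11, row L02),
(isoG, houter, map_H) "the outer isomorphism `G₁ ⥲ G₂` over which `Ψ_Base` lies, mapping `H₁` onto `H₂`"
([FrdII] Ex. 1.3 (i) / Thm. 2.4 setting), (hfs) "`Φ₁` fieldwise saturated iff `Φ₂`" (row L03, abc-iut-w5-d229's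
`isFieldwiseSaturated_iff_of_equiv'`) — **the typed Theorem 2.4 (i) (`PadicKummer.Thm24i`) holds for the Definition 2.2
contexts OF THE OBJECTS `A₁`, `Ψ A₁` (`contextOfObject`, files D1–D3b), the context isomorphism INDUCED BY `Ψ`
(`GaloisChart.isoOfFunctor`, file D4) and the cup-product duality isomorphisms**: `thm24i_ofFunctor`. Every other
ingredient — `O^▷(Aᵢ)` with the conjugation action, the descended Galois actions, `Aut_C(A) ↠ Gal(K_A/ℚ_p)`
(Galois correspondence + `Aut`-ampleness), `μ_N(Aᵢ) ≅ μ_N(ℚ̄_{pᵢ})`, `p₁ = p₂` ([AbsAnab] 1.2.1 (i)), local Tate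
duality, saturation transfer, Kummer and reciprocity compatibility — is CONSTRUCTED or PROVED in the tree.
Nothing here concerns [IUTchIII]; classical.
-/

noncomputable section

namespace Literature.AlgebraicGeometry.Frobenioids

namespace PadicKummer.Def22Context

open CategoryTheory Field IntermediateField Kummer Function
open Literature.NumberTheory.GaloisRepresentations
open Literature.AnabelianGeometry.SemiGraphs QuasiTemperoid PadicFrd PadicFrd.Datum PadicFrd.Datum.GaloisChart

variable {p₁ p₂ : ℕ} [Fact p₁.Prime] [Fact p₂.Prime]
  {d₁ : PadicFrd.Datum (CosetCat (GalFbar ℚ_[p₁])) p₁} (hd₁ : d₁.base = galoisCosetBase p₁)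
  {d₂ : PadicFrd.Datum (CosetCat (GalFbar ℚ_[p₂])) p₂} (hd₂ : d₂.base = galoisCosetBase p₂)
  (F : d₁.frobenioid ⥤ d₂.frobenioid) [F.Full] [F.Faithful] {A₁ : d₁.frobenioid}
  (hA₁ : A₁.base.sg.toSubgroup.Normal) (hA₂ : (F.obj A₁).base.sg.toSubgroup.Normal)
  (hO : ∀ f : A₁ ⟶ A₁, f ∈ PreFrobenioid.endSubmonoid d₁.structureFunctor A₁ ↔
    F.map f ∈ PreFrobenioid.endSubmonoid d₂.structureFunctor (F.obj A₁))
  {H₁ : Subgroup (absoluteGaloisGroup ℚ_[p₁])} [H₁.Normal] {hH₁ : IsOpen (H₁ : Set (absoluteGaloisGroup ℚ_[p₁]))}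
  {H₂ : Subgroup (absoluteGaloisGroup ℚ_[p₂])} [H₂.Normal] {hH₂ : IsOpen (H₂ : Set (absoluteGaloisGroup ℚ_[p₂]))}
  (isoG : absoluteGaloisGroup ℚ_[p₁] ≃ₜ* absoluteGaloisGroup ℚ_[p₂])
  (houter : haveI := normal_objField d₁ A₁ hA₁; haveI := normal_objField d₂ (F.obj A₁) hA₂
    ∀ g : absoluteGaloisGroup ℚ_[p₁], resGal (objField d₂ (F.obj A₁)) (isoG g) =
      galEquiv F (galoisChartCoset d₁ hd₁ A₁) (galoisChartCoset d₂ hd₂ (F.obj A₁)) hO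
        (resAut_eq_one_iff d₁ A₁) (resAut_eq_one_iff d₂ (F.obj A₁)) (resGal (objField d₁ A₁) g))
  (map_H : H₁.map isoG.toMulEquiv.toMonoidHom = H₂)
  (N : ℕ) [NeZero N]
  (hμ₁ : ∀ ζ : rootsOfUnity N (AlgebraicClosure ℚ_[p₁]),
    ((ζ : (AlgebraicClosure ℚ_[p₁])ˣ) : AlgebraicClosure ℚ_[p₁]) ∈ objField d₁ A₁)
  (hμ₂ : ∀ ζ : rootsOfUnity N (AlgebraicClosure ℚ_[p₂]),
    ((ζ : (AlgebraicClosure ℚ_[p₂])ˣ) : AlgebraicClosure ℚ_[p₂]) ∈ objField d₂ (F.obj A₁))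
  [LocallyCompactSpace (contextOfObject d₁ hd₁ A₁ hA₁ H₁ hH₁).H]
  [LocallyCompactSpace (contextOfObject d₂ hd₂ (F.obj A₁) hA₂ H₂ hH₂).H]

/-- **The isomorphism of the Definition 2.2 contexts of `A₁` and `Ψ A₁` induced by `Ψ`** (file D4's `isoOfFunctor`
at the charts of §2; `hker` discharged by `resAut_eq_one_iff`, the Galois clause by `isGalois_objField`).
[cite: MochizukiFrdII2008, Thm 2.4 (i) p.19] -/
def isoOfFunctorCoset : (contextOfObject d₁ hd₁ A₁ hA₁ H₁ hH₁).Iso (contextOfObject d₂ hd₂ (F.obj A₁) hA₂ H₂ hH₂) :=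
  haveI := finiteDimensional_objField d₁ A₁; haveI := normal_objField d₁ A₁ hA₁
  haveI := finiteDimensional_objField d₂ (F.obj A₁); haveI := normal_objField d₂ (F.obj A₁) hA₂
  isoOfFunctor F (galoisChartCoset d₁ hd₁ A₁) (galoisChartCoset d₂ hd₂ (F.obj A₁)) hO
    (resAut_eq_one_iff d₁ A₁) (resAut_eq_one_iff d₂ (F.obj A₁)) H₁ hH₁ H₂ hH₂ isoG houter map_H
    ⟨fun _ => isGalois_objField d₂ (F.obj A₁) hA₂, fun _ => isGalois_objField d₁ A₁ hA₁⟩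

/-- **[FrdII] Theorem 2.4 (i) for the `p`-adic Frobenioids of §2 themselves.** For `Ψ : C₁ ⥤ C₂` fully faithful
between `pᵢ`-adic Frobenioids over the bases `B(G_{ℚ_{pᵢ}})⁰ → D₀`, an object `A₁` with `(A₁)_D`, `(Ψ A₁)_D` Galois,
`μ_N(ℚ̄_{pᵢ}) ⊆ K_{Aᵢ}`, `A₁` `(N, H₁)`-saturated, any normalisation `F_N(A₁) ≅ ℤ/N`, and the printed inputs by name
— "`Ψ` preserves `O^⊳(−)`" (`hO`, [FrdI] Cor. 4.10/4.11), the outer isomorphism `G₁ ⥲ G₂` over `Ψ_Base` carrying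
`H₁` to `H₂` (`isoG`, `houter`, `map_H`), "`Φ₁` fieldwise saturated iff `Φ₂`" (`hfs`) — the typed `Thm24i` holds
for the contexts of `A₁`, `Ψ A₁`, the comparison data of the context isomorphism induced by `Ψ`, and the
cup-product duality isomorphisms: "`p₁ = p₂`", "`Ψ` maps `(N, H₁)`-saturated objects to `(N, H₂)`-saturated
objects", and the compatibility of the induced isomorphisms with the Kummer and reciprocity maps.
[cite: MochizukiFrdII2008, Thm 2.4 (i) p.19] -/
theorem thm24i_ofFunctor (fs₁ fs₂ : Prop) (hfs : fs₁ ↔ fs₂)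
    (eFN₁ : FN (contextOfObject d₁ hd₁ A₁ hA₁ H₁ hH₁) N ≃+ ZMod N)
    (hc₁ : IsNHSaturated (contextOfObject d₁ hd₁ A₁ hA₁ H₁ hH₁) N) :
    haveI := finiteDimensional_objField d₁ A₁; haveI := normal_objField d₁ A₁ hA₁
    haveI := finiteDimensional_objField d₂ (F.obj A₁); haveI := normal_objField d₂ (F.obj A₁) hA₂
    letI := (galoisChartCoset d₁ hd₁ A₁).galAction; letI := (galoisChartCoset d₂ hd₂ (F.obj A₁)).galAction
    Thm24i (contextOfObject d₁ hd₁ A₁ hA₁ H₁ hH₁) (contextOfObject d₂ hd₂ (F.obj A₁) hA₂ H₂ hH₂) N p₁ p₂ fs₁ fs₂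
      ((isoOfFunctorCoset hd₁ hd₂ F hA₁ hA₂ hO isoG houter map_H).thm24Data N)
      ((contextOfObject d₁ hd₁ A₁ hA₁ H₁ hH₁).dualityIsoOfLocalDuality N eFN₁ hc₁
        (cupDualH_bijective_ofGalois_mlf p₁ (objField d₁ A₁) H₁ hH₁ (galoisChartCoset d₁ hd₁ A₁).res
          (galoisChartCoset d₁ hd₁ A₁).res_smul ((galoisChartCoset d₁ hd₁ A₁).muModel N hμ₁)))
      ((contextOfObject d₂ hd₂ (F.obj A₁) hA₂ H₂ hH₂).dualityIsoOfLocalDuality N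
        (((isoOfFunctorCoset hd₁ hd₂ F hA₁ hA₂ hO isoG houter map_H).isoFN N).symm.trans eFN₁)
        (((isoOfFunctorCoset hd₁ hd₂ F hA₁ hA₂ hO isoG houter map_H).isNHSaturated_iff N).mp hc₁)
        (cupDualH_bijective_ofGalois_mlf p₂ (objField d₂ (F.obj A₁)) H₂ hH₂ (galoisChartCoset d₂ hd₂ (F.obj A₁)).res
          (galoisChartCoset d₂ hd₂ (F.obj A₁)).res_smul ((galoisChartCoset d₂ hd₂ (F.obj A₁)).muModel N hμ₂))) :=
  thm24i_ofObjects hd₁ hA₁ hd₂ hA₂ (isoOfFunctorCoset hd₁ hd₂ F hA₁ hA₂ hO isoG houter map_H) N hμ₁ hμ₂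
    fs₁ fs₂ hfs eFN₁ hc₁

/-! ### Non-vacuity: the `p`-adic Frobenioid `C₀|_{B(G_{ℚ_p})⁰}` of Ex. 1.1 (i) -/

/-- The hypotheses `hd`, `hA` are inhabited: for the `p`-adic Frobenioid `C₀` of Ex. 1.1 (i) restricted to
`B(G_{ℚ_p})⁰` (abc-iut-L1-t4's `Datum.zero` over abc-iut-w5-d229's base, `hd := rfl`) and its object over
`G_{ℚ_p}/G_{ℚ_p}` with trivial class, `contextOfObject` IS a Definition 2.2 context whose `Aut_C` is the object's
automorphism group (kernel witness that the construction elaborates on genuine data).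
[cite: MochizukiFrdII2008, Ex 1.1 (i) p.7] -/
theorem contextOfObject_zero_AutC (p : ℕ) [Fact p.Prime] (H : Subgroup (absoluteGaloisGroup ℚ_[p])) [H.Normal]
    (hH : IsOpen (H : Set (absoluteGaloisGroup ℚ_[p]))) :
    let d₀ : PadicFrd.Datum (CosetCat (GalFbar ℚ_[p])) p := PadicFrd.Datum.zero (galoisCosetBase p)
      (isPadicLocal_galoisCosetBase p) CosetCat.isConnected CosetCat.isTotallyEpimorphic
      (isMonoprime_ordInt_galoisCosetBase p)
    let A₀ : d₀.frobenioid := ⟨⟨⊤⟩, 1⟩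
    (contextOfObject d₀ rfl A₀ (inferInstanceAs ((⊤ : Subgroup (GalFbar ℚ_[p])).Normal)) H hH).AutC = Aut A₀ :=
  rfl

end PadicKummer.Def22Context

end Literature.AlgebraicGeometry.Frobenioids

end
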